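import Summits.AtomisticToContinuum.HydrodynamicLimit.Theorems.InformationPercolationEnginePercolationClosesChaosForecastRobustDefs
import Summits.AtomisticToContinuum.HydrodynamicLimit.Theorems.InformationPercolationEnginePercolationClosesChaosCesaroLocalEquilibrium
import HarnessLib

/-!
# Local equilibrium S5 of the line `equilibrium-forecast-chain-rule` (crux `InformationPercolationEngine.PercolationClosesChaos`,
stmt-AtomisticToContinuum-15178) — the registered stub `stub_cesaroW` of skeleton v9 (lead c4, worker W4): the COLLISION-WEIGHTED
static Cesàro assembly

Closes the registered stub
`stub_cesaroW : MesoStaticMaxwellRarityW → LocalCountUI → NoKineticIrregularityB → CoarseLocalMaxwellianityW`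
(collision-weighted local Maxwellianity of the EVOLVED law at the kinetic-cell scale, in the mean, from the weighted static
rarity statement under the invariant law, the packed-cell input `LocalCountUI` (ii) and the binned kinetic-irregularity input).
It is the weighted re-run of the v5 template `stub_cesaroLocalEquilibrium` (`…CesaroLocalEquilibrium.lean`) over
`lintegral_nonMaxwellian_floor_le` (`…CesaroStaticAssemblyFloor.lean`), with weights `W = min(ownedCount (k,q), T) ∈ [0, T]`
and velocities read through `binConfig b`:

* `cesaroW_measurable_binConfig` — `w ↦ binConfig b w` is measurable (positions untouched; velocities go through the countable
  bin type), hence the binned inhomogeneity along the flow and the `NoKineticIrregularityB` unit event are measurable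
  (`cesaroW_measurable_inhomB_flow`, `cesaroW_measurableSet_irregularB`);
* `clmIndicatorW_le` — the pointwise split, per unit, with `w` the configuration at `kΔ`:
  `𝟙{occupied ∧ ϑ < relEnt_b}·W ≤ 𝟙{Regular_b ∧ m₀ ≤ #pop ∧ ϑ ≤ relEnt_b}·W + T·𝟙{occupied ∧ Dense}
   + T·𝟙{actual ∧ nbhd ≠ ∅ ∧ (ϑh < inhom_b ∨ (occupied ∧ #pop < m₀))}`
  (an occupied cell is an actual cell with a populated neighbourhood, `actual_and_nbhd_of_pop_nonempty`; `Regular` on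
  `binConfig b w` unfolds through `dense_binConfig_iff`, `pop_binConfig`, `nbhd_binConfig`);
* `lintegral_weightedSplit_le` — the fixed-`N` assembly for probability laws `μ` (evolved), `ν` (reference) with
  `KL(μ‖ν) ≤ A(N+1)`: a box-supported family `F ≤ R + T·𝟙_D + T·𝟙_I` with `0 ≤ R ≤ T` box-supported,
  `ν{δ' < unitAvg R} ≤ e^{-L(N+1)}`, `∫⁻ unitAvg 𝟙_D dμ ≤ δ₁`, `∫⁻ unitAvg 𝟙_I dμ ≤ δ₂` (measurable unit events) has
  `∫⁻ unitAvg F dμ ≤ ofReal(δ' + 27 T (log 2 + A)/L) + T δ₁ + T δ₂` — the first family is transferred WITHOUT measurability by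
  `lintegral_ofReal_le_of_measure_le_exp` (piece T′, values in `[0, 27 T]` on a mesh `cℓ_N ≤ 1`), so the weight
  `min(ownedCount, T)` never needs to be measurable; the two indicator families are split off by `lintegral_add_right`;
* `stub_cesaroW` (the headline) — quantifier bookkeeping: `σ₀ := min (min σ₁ σ_UI) (min σ_NKI (1/2))`; given `δ, T` take
  `δ' := δ/4`, `L := 108 T (log 2 + A)/δ` (so `27 T (log 2 + A)/L = δ/4`) in `MesoStaticMaxwellRarityW`, and `δ/(4T)` in
  `LocalCountUI` (ii) and in `NoKineticIrregularityB` (at the `(m₀, ϑh)` the rarity statement returns); `c₀ := max`,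
  `b₀ := min` of the two bin thresholds, `N₀ := max` of the three thresholds and of the mesh threshold `exists_mesh_le_one`.
-/

noncomputable section

open MeasureTheory Set Filter Topology
open scoped ENNReal BigOperators Classical
open Literature.Analysis.FluidPDE Literature.MathematicalPhysics.KineticTheory
open Literature.MathematicalPhysics.KineticTheory.VelocityBlindPlacement

namespace Summit.AtomisticToContinuum.HydrodynamicLimit.Theorems.EquilibriumForecastLine

variable {σ : ℝ} {N : ℕ}

/-! ## Measurability of the binned configuration and of the binned unit events -/

/-- **`w ↦ binConfig b w` is measurable**: positions are kept, and each velocity goes through the velocity-bin map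
`v ↦ (⌊v_m / b⌋)_m` (measurable: floor of a coordinate) into the COUNTABLE discrete type `Cell`, out of which every map
(`binCentre b`) is measurable. [folklore] -/
theorem cesaroW_measurable_binConfig (b : ℝ) : Measurable (binConfig (N := N) b) := by
  have hv : Measurable (velBin b) := by
    refine measurable_pi_lambda _ fun m => ?_
    have h1 : Measurable fun v : V3 => v m :=
      (measurable_pi_apply m).comp (WithLp.measurable_ofLp 2 (Fin 3 → ℝ))
    exact Int.measurable_floor.comp (h1.div_const b)
  refine measurable_pi_lambda _ fun i => ((measurable_pi_apply i).fst).prodMk ?_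
  exact ((measurable_of_countable (binCentre b)).comp hv).comp (measurable_pi_apply i).snd

/-- The BINNED inhomogeneity of cell `q` in its neighbourhood at time `t` along the flow is a measurable function of the initial
datum (`measurable_inhom_pop_nbhd` of piece M composed with `binConfig b ∘ Φ.flow t`; populations do not see the binning).
[folklore] -/
theorem cesaroW_measurable_inhomB_flow (Φ : Flow σ N) (ϑs b c t : ℝ) (q : Cell) :
    Measurable fun z : Phase N =>
      inhom ϑs (binConfig b (Φ.flow t z)) (pop c σ N (Φ.flow t z) q) (nbhd c σ N (Φ.flow t z) q) := by
  have h : (fun z : Phase N =>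
      inhom ϑs (binConfig b (Φ.flow t z)) (pop c σ N (Φ.flow t z) q) (nbhd c σ N (Φ.flow t z) q)) =
      (fun w : Phase N => inhom ϑs w (pop c σ N w q) (nbhd c σ N w q)) ∘ binConfig b ∘ Φ.flow t := by
    funext z
    simp only [Function.comp_apply, pop_binConfig, nbhd_binConfig]
  rw [h]
  exact ((measurable_inhom_pop_nbhd ϑs c σ q).comp (cesaroW_measurable_binConfig b)).comp (Φ.measurable_flow t)

/-- The unit event of `NoKineticIrregularityB` at time `t` — actual cell, populated neighbourhood, and binned-inhomogeneous or
occupied-under-populated — is measurable. [folklore] -/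
theorem cesaroW_measurableSet_irregularB (Φ : Flow σ N) (ϑs ϑh b c t : ℝ) (m₀ : ℕ) (q : Cell) :
    MeasurableSet {z : Phase N | (∃ x : T3, cellOf c σ N x = q) ∧ (nbhd c σ N (Φ.flow t z) q).Nonempty ∧
      (ϑh < inhom ϑs (binConfig b (Φ.flow t z)) (pop c σ N (Φ.flow t z) q) (nbhd c σ N (Φ.flow t z) q) ∨
        ((pop c σ N (Φ.flow t z) q).Nonempty ∧ (pop c σ N (Φ.flow t z) q).card < m₀))} :=
  (MeasurableSet.const _).inter (((measurableSet_nbhd_nonempty c σ q).preimage (Φ.measurable_flow t)).inter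
    ((measurableSet_lt measurable_const (cesaroW_measurable_inhomB_flow Φ ϑs b c t q)).union
      (((measurableSet_pop_nonempty c σ q).preimage (Φ.measurable_flow t)).inter
        ((measurableSet_card_pop_lt c σ m₀ q).preimage (Φ.measurable_flow t)))))

/-! ## The pointwise weighted split -/

/-- A weighted indicator with weight `min x T`, `0 ≤ T`, is at most `T`. [folklore] -/
theorem weighted_le_T {P : Prop} [Decidable P] (x : ℝ) {T : ℝ} (hT : 0 ≤ T) :
    (if P then (1 : ℝ) else 0) * min x T ≤ T := by
  split_ifs
  · rw [one_mul]
    exact min_le_right x T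
  · rwa [zero_mul]

/-- **The pointwise split of the `CoarseLocalMaxwellianityW` summand** (weight `W = min x T` with `0 ≤ x`, `0 ≤ T`; velocities
read through `binConfig b`): occupied ∧ non-Maxwellian, weighted, is at most (binned-regular ∧ at least `m₀` spheres ∧
non-Maxwellian, weighted) + `T` · (occupied ∧ packed) + `T` · (the `NoKineticIrregularityB` event: actual cell with populated
neighbourhood, binned-inhomogeneous or occupied by fewer than `m₀` spheres). [folklore] -/
theorem clmIndicatorW_le {c : ℝ} (hc : 0 ≤ c * meanFreePath σ N) (ϑs ϑ ϑh φs b : ℝ) (m₀ : ℕ) (w : Phase N) (q : Cell)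
    {x T : ℝ} (hx : 0 ≤ x) (hT : 0 ≤ T) :
    (if (pop c σ N w q).Nonempty ∧ ϑ < relEnt ϑs (binConfig b w) (pop c σ N w q) then (1 : ℝ) else 0) * min x T ≤
      (if Regular ϑs ϑh φs c σ N (binConfig b w) q ∧ m₀ ≤ (pop c σ N w q).card ∧
          ϑ ≤ relEnt ϑs (binConfig b w) (pop c σ N w q) then (1 : ℝ) else 0) * min x T +
        T * (if (pop c σ N w q).Nonempty ∧ Dense φs c σ N w q then (1 : ℝ) else 0) +
        T * (if (∃ y : T3, cellOf c σ N y = q) ∧ (nbhd c σ N w q).Nonempty ∧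
              (ϑh < inhom ϑs (binConfig b w) (pop c σ N w q) (nbhd c σ N w q) ∨
                ((pop c σ N w q).Nonempty ∧ (pop c σ N w q).card < m₀)) then (1 : ℝ) else 0) := by
  have hW0 : 0 ≤ min x T := le_min hx hT
  have hWT : min x T ≤ T := min_le_right x T
  by_cases h : (pop c σ N w q).Nonempty ∧ ϑ < relEnt ϑs (binConfig b w) (pop c σ N w q)
  swap
  · rw [if_neg h, zero_mul]
    positivity
  obtain ⟨hne, hlt⟩ := h
  rw [if_pos ⟨hne, hlt⟩, one_mul]
  have hqn := actual_and_nbhd_of_pop_nonempty hc w q hne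
  split_ifs <;> try linarith
  -- the remaining branch: not binned-regular-populated-non-Maxwellian, not packed, not irregular — impossible
  rename_i h₁ h₂ h₃
  refine (h₁ ⟨⟨fun hD => h₂ ⟨hne, (dense_binConfig_iff b φs c σ w q).1 hD⟩, ?_⟩,
    not_lt.1 fun hC => h₃ ⟨hqn.1, hqn.2, Or.inr ⟨hne, hC⟩⟩, hlt.le⟩).elim
  rw [pop_binConfig, nbhd_binConfig]
  exact not_lt.1 fun hI => h₃ ⟨hqn.1, hqn.2, Or.inl hI⟩

/-! ## The fixed-`N` weighted assembly -/

/-- **The fixed-`N` weighted assembly.** For probability laws `μ` (evolved) and `ν` (reference) on the phase space with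
`KL(μ‖ν) ≤ A(N+1)`, cell size `0 < h ≤ 1`, `δ' ≥ 0`, `L > 0`, `T ≥ 0`: if a box-supported unit family `F` is dominated per unit
by `R + T·𝟙_D + T·𝟙_I` with `R ∈ [0, T]` box-supported, `𝟙_D`, `𝟙_I` box-supported indicator families of measurable unit
events, `ν{δ' < unitAvg R} ≤ e^{-L(N+1)}`, `∫⁻ unitAvg 𝟙_D dμ ≤ δ₁` and `∫⁻ unitAvg 𝟙_I dμ ≤ δ₂`, then
`∫⁻ unitAvg F dμ ≤ ofReal (δ' + 27 T (log 2 + A)/L) + T δ₁ + T δ₂` (entropy-inequality transfer of piece T′ for `unitAvg R`,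
which takes values in `[0, 27 T]` and needs no measurability; additivity of lower integrals against the two measurable
indicator averages). [folklore] -/
theorem lintegral_weightedSplit_le (μ ν : Measure (Phase N)) [IsProbabilityMeasure μ] [IsProbabilityMeasure ν] {c : ℝ}
    (τ : ℝ) {δ' A L T : ℝ} {δ₁ δ₂ ε : ℝ≥0∞} {F R : ℕ → Cell → Phase N → ℝ} {PD PI : ℕ → Cell → Phase N → Prop}
    {instD : ∀ k q z, Decidable (PD k q z)} {instI : ∀ k q z, Decidable (PI k q z)}
    (h0 : 0 < c * meanFreePath σ N) (h1 : c * meanFreePath σ N ≤ 1) (hδ' : 0 ≤ δ') (hA : 0 ≤ A) (hL : 0 < L) (hT : 0 ≤ T)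
    (hKL : InformationTheory.klDiv μ ν ≤ ENNReal.ofReal (A * ((N : ℝ) + 1)))
    (hFb : ∀ (z : Phase N) (k : ℕ), ∀ q ∉ cellBox (c * meanFreePath σ N), F k q z = 0)
    (hRb : ∀ (z : Phase N) (k : ℕ), ∀ q ∉ cellBox (c * meanFreePath σ N), R k q z = 0)
    (hDb : ∀ (z : Phase N) (k : ℕ), ∀ q ∉ cellBox (c * meanFreePath σ N), (if PD k q z then (1 : ℝ) else 0) = 0)
    (hIb : ∀ (z : Phase N) (k : ℕ), ∀ q ∉ cellBox (c * meanFreePath σ N), (if PI k q z then (1 : ℝ) else 0) = 0)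
    (hR0 : ∀ k q z, 0 ≤ R k q z) (hRT : ∀ k q z, R k q z ≤ T)
    (hle : ∀ k q z, F k q z ≤ R k q z + T * (if PD k q z then (1 : ℝ) else 0) + T * (if PI k q z then (1 : ℝ) else 0))
    (hmD : ∀ k q, MeasurableSet {z | PD k q z}) (hmI : ∀ k q, MeasurableSet {z | PI k q z})
    (hν : ν {z | δ' < unitAvg c σ N τ fun k q => R k q z} ≤ ENNReal.ofReal (Real.exp (-(L * ((N : ℝ) + 1)))))
    (hD : ∫⁻ z, ENNReal.ofReal (unitAvg c σ N τ fun k q => if PD k q z then (1 : ℝ) else 0) ∂μ ≤ δ₁)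
    (hI : ∫⁻ z, ENNReal.ofReal (unitAvg c σ N τ fun k q => if PI k q z then (1 : ℝ) else 0) ∂μ ≤ δ₂)
    (hε : ENNReal.ofReal (δ' + 27 * T * ((Real.log 2 + A) / L)) + ENNReal.ofReal T * δ₁ + ENNReal.ofReal T * δ₂ ≤ ε) :
    ∫⁻ z, ENNReal.ofReal (unitAvg c σ N τ fun k q => F k q z) ∂μ ≤ ε := by
  -- the three unit averages
  set UR : Phase N → ℝ := fun z => unitAvg c σ N τ fun k q => R k q z with hUR
  set UD : Phase N → ℝ := fun z => unitAvg c σ N τ fun k q => if PD k q z then (1 : ℝ) else 0 with hUD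
  set UI : Phase N → ℝ := fun z => unitAvg c σ N τ fun k q => if PI k q z then (1 : ℝ) else 0 with hUI
  have hTDb : ∀ (z : Phase N) (k : ℕ), ∀ q ∉ cellBox (c * meanFreePath σ N),
      T * (if PD k q z then (1 : ℝ) else 0) = 0 := fun z k q hq => by rw [hDb z k q hq, mul_zero]
  have hTIb : ∀ (z : Phase N) (k : ℕ), ∀ q ∉ cellBox (c * meanFreePath σ N),
      T * (if PI k q z then (1 : ℝ) else 0) = 0 := fun z k q hq => by rw [hIb z k q hq, mul_zero]
  have hRDb : ∀ (z : Phase N) (k : ℕ), ∀ q ∉ cellBox (c * meanFreePath σ N),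
      R k q z + T * (if PD k q z then (1 : ℝ) else 0) = 0 := fun z k q hq => by
    rw [hRb z k q hq, hTDb z k q hq, add_zero]
  -- pointwise split of the unit averages
  have hsplit : ∀ z, (unitAvg c σ N τ fun k q => F k q z) ≤ UR z + T * UD z + T * UI z := by
    intro z
    rw [hUR, hUD, hUI]
    simp only
    rw [← unitAvg_const_mul' c σ N τ T (fun k q => if PD k q z then (1 : ℝ) else 0),
      ← unitAvg_const_mul' c σ N τ T (fun k q => if PI k q z then (1 : ℝ) else 0),
      ← unitAvg_add' τ (hRb z) (hTDb z), ← unitAvg_add' τ (hRDb z) (hTIb z)]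
    exact unitAvg_mono h0.le (hFb z) (fun k q hq => by rw [hRDb z k q hq, hTIb z k q hq, add_zero]) fun k q => hle k q z
  have hUR0 : ∀ z, 0 ≤ UR z := fun z => unitAvg_nonneg h0.le (hRb z) fun k q => hR0 k q z
  have hUD0 : ∀ z, 0 ≤ UD z := fun z => unitAvg_nonneg h0.le (hDb z) fun k q => by positivity
  have hUI0 : ∀ z, 0 ≤ UI z := fun z => unitAvg_nonneg h0.le (hIb z) fun k q => by positivity
  have hUR27 : ∀ z, UR z ≤ 27 * T := fun z => unitAvg_le_mul_of_le τ hT h0 h1 (hRb z) fun k q => hRT k q z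
  -- measurability of the two indicator averages
  have hmUD : Measurable UD := measurable_unitAvg_indicator τ PD hmD hDb
  have hmUI : Measurable UI := measurable_unitAvg_indicator τ PI hmI hIb
  have hmTD : Measurable fun z => ENNReal.ofReal (T * UD z) := (hmUD.const_mul T).ennreal_ofReal
  have hmTI : Measurable fun z => ENNReal.ofReal (T * UI z) := (hmUI.const_mul T).ennreal_ofReal
  have hTD : ∫⁻ z, ENNReal.ofReal (T * UD z) ∂μ = ENNReal.ofReal T * ∫⁻ z, ENNReal.ofReal (UD z) ∂μ := by
    rw [← lintegral_const_mul _ hmUD.ennreal_ofReal]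
    exact lintegral_congr fun z => ENNReal.ofReal_mul hT
  have hTI : ∫⁻ z, ENNReal.ofReal (T * UI z) ∂μ = ENNReal.ofReal T * ∫⁻ z, ENNReal.ofReal (UI z) ∂μ := by
    rw [← lintegral_const_mul _ hmUI.ennreal_ofReal]
    exact lintegral_congr fun z => ENNReal.ofReal_mul hT
  -- integrate: the first family is transferred without measurability
  have hRint : ∫⁻ z, ENNReal.ofReal (UR z) ∂μ ≤ ENNReal.ofReal (δ' + 27 * T * ((Real.log 2 + A) / L)) :=
    lintegral_ofReal_le_of_measure_le_exp μ ν UR hδ' (by positivity) hUR27 hA hL N hν hKL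
  calc ∫⁻ z, ENNReal.ofReal (unitAvg c σ N τ fun k q => F k q z) ∂μ
      ≤ ∫⁻ z, ENNReal.ofReal (UR z) + ENNReal.ofReal (T * UD z) + ENNReal.ofReal (T * UI z) ∂μ := by
        refine lintegral_mono fun z => ?_
        rw [← ENNReal.ofReal_add (hUR0 z) (mul_nonneg hT (hUD0 z)),
          ← ENNReal.ofReal_add (add_nonneg (hUR0 z) (mul_nonneg hT (hUD0 z))) (mul_nonneg hT (hUI0 z))]
        exact ENNReal.ofReal_le_ofReal (hsplit z)
    _ = (∫⁻ z, ENNReal.ofReal (UR z) ∂μ) + ENNReal.ofReal T * (∫⁻ z, ENNReal.ofReal (UD z) ∂μ) +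
          ENNReal.ofReal T * ∫⁻ z, ENNReal.ofReal (UI z) ∂μ := by
        rw [lintegral_add_right _ hmTI, lintegral_add_right _ hmTD, hTD, hTI]
    _ ≤ ENNReal.ofReal (δ' + 27 * T * ((Real.log 2 + A) / L)) + ENNReal.ofReal T * δ₁ + ENNReal.ofReal T * δ₂ := by
        gcongr
    _ ≤ ε := hε

/-! ## The headline -/

/-- **Registered stub `stub_cesaroW` (S5 of skeleton v9, the weighted static Cesàro assembly): collision-weighted local
equilibrium of the evolved law at the kinetic-cell scale, in the mean —
`MesoStaticMaxwellRarityW → LocalCountUI → NoKineticIrregularityB → CoarseLocalMaxwellianityW`.** Under the INVARIANT law `G_N`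
the unit average of `𝟙{binned-regular, m₀-populated, ϑ-non-Maxwellian (binned)} · min(ownedCount, T)` exceeds `δ' = δ/4` only
with probability `e^{-L(N+1)}`, `L = 108 T (log 2 + A)/δ`; the entropy inequality with `KL(LG‖G_N) ≤ A(N+1)`
(`exists_lgTransferConst`) turns this `[0, 27 T]`-valued average into an `LG`-mean `≤ δ' + 27 T (log 2 + A)/L = δ/2`; occupied
packed cells (`LocalCountUI` (ii)) and the `NoKineticIrregularityB` cells (binned `ϑh`-inhomogeneous, or occupied by fewer than
`m₀` spheres — an occupied cell is an actual cell with populated neighbourhood) have unit-fractions of `LG`-mean `≤ δ/(4T)` and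
enter with the factor `T`; the pointwise split `clmIndicatorW_le` and the fixed-`N` assembly `lintegral_weightedSplit_le` add
them up. [folklore] -/
theorem stub_cesaroW : MesoStaticMaxwellRarityW → LocalCountUI → NoKineticIrregularityB → CoarseLocalMaxwellianityW := by
  intro hM hUI hNI a₀ θ₀ u₀ ha hθ hu ha0 hθ0
  obtain ⟨φs, hφs, σ₁, hσ₁, hM⟩ := hM
  obtain ⟨σU, hσU, hUI⟩ := hUI φs hφs a₀ θ₀ u₀ ha hθ hu ha0 hθ0
  obtain ⟨σI, hσI, hNI⟩ := hNI a₀ θ₀ u₀ ha hθ hu ha0 hθ0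
  refine ⟨min (min σ₁ σU) (min σI (1 / 2)), by positivity, fun σ hσ hσlt Φ τ hτ ϑs ϑ δ T hϑs hϑ hδ hT => ?_⟩
  have hσ1 : σ ≤ σ₁ := hσlt.le.trans ((min_le_left _ _).trans (min_le_left _ _))
  have hσU' : σ < σU := hσlt.trans_le ((min_le_left _ _).trans (min_le_right _ _))
  have hσI' : σ < σI := hσlt.trans_le ((min_le_right _ _).trans (min_le_left _ _))
  have hσ2 : σ ≤ 1 / 2 := hσlt.le.trans ((min_le_right _ _).trans (min_le_right _ _))
  -- the transfer constant
  obtain ⟨A, hA, hTr⟩ := exists_lgTransferConst ha hθ hu ha0 hθ0 hσ2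
  -- tolerances
  have hl2 : 0 < Real.log 2 := Real.log_pos one_lt_two
  set δ' : ℝ := δ / 4 with hδ'
  set L : ℝ := 4 * 27 * T * (Real.log 2 + A) / δ with hL
  have hδ'0 : 0 < δ' := by positivity
  have hL0 : 0 < L := by positivity
  have hδT : 0 < δ / (4 * T) := by positivity
  have hLval : 27 * T * ((Real.log 2 + A) / L) = δ / 4 := by
    rw [hL]
    field_simp
  have hTval : T * (δ / (4 * T)) = δ / 4 := by
    field_simp
  -- the three inputs
  obtain ⟨m₀, ϑh, hϑh, cM, hcM, hM⟩ := hM σ hσ hσ1 Φ τ hτ ϑs ϑ δ' L T hϑs hϑ hδ'0 hL0 hT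
  obtain ⟨-, cU, hcU, hU⟩ := hUI σ hσ hσU' Φ τ hτ (δ / (4 * T)) hδT
  obtain ⟨cI, hcI, hI⟩ := hNI σ hσ hσI' Φ τ hτ ϑs ϑh (δ / (4 * T)) m₀ hϑs hϑh hδT
  refine ⟨max cM (max cU cI), lt_max_of_lt_left hcM, fun c hc => ?_⟩
  have hcM' : cM ≤ c := (le_max_left _ _).trans hc
  have hcU' : cU ≤ c := ((le_max_left _ _).trans (le_max_right _ _)).trans hc
  have hcI' : cI ≤ c := ((le_max_right _ _).trans (le_max_right _ _)).trans hc
  have hc0 : 0 < c := hcM.trans_le hcM'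
  obtain ⟨bM, hbM, hM⟩ := hM c hcM'
  obtain ⟨NU, hNU⟩ := hU c hcU'
  obtain ⟨bI, hbI, hI⟩ := hI c hcI'
  refine ⟨min bM bI, lt_min hbM hbI, fun b hb hble => ?_⟩
  obtain ⟨NM, hNM⟩ := hM b hb (hble.trans (min_le_left _ _))
  obtain ⟨NI, hNI⟩ := hI b hb (hble.trans (min_le_right _ _))
  obtain ⟨N1, hN1⟩ := exists_mesh_le_one hσ c
  refine ⟨max (max NM NU) (max NI N1), fun N hN => ?_⟩
  have hNM' : NM ≤ N := ((le_max_left _ _).trans (le_max_left _ _)).trans hN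
  have hNU' : NU ≤ N := ((le_max_right _ _).trans (le_max_left _ _)).trans hN
  have hNI' : NI ≤ N := ((le_max_left _ _).trans (le_max_right _ _)).trans hN
  have hN1' : N1 ≤ N := ((le_max_right _ _).trans (le_max_right _ _)).trans hN
  have hh0 : 0 < c * meanFreePath σ N := mul_pos hc0 (meanFreePath_pos hσ N)
  have hh1 : c * meanFreePath σ N ≤ 1 := hN1 N hN1'
  obtain ⟨hKL, -, -, -, -⟩ := hTr N (Φ N)
  haveI : IsProbabilityMeasure (localGibbsLaw σ a₀ u₀ θ₀ N (Φ N)) :=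
    isProbabilityMeasure_localGibbsLaw ha hθ hu ha0 hθ0 hσ2 N (Φ N)
  haveI : IsProbabilityMeasure (eqLaw σ N (Φ N)) :=
    isProbabilityMeasure_localGibbsLaw (a₀ := fun _ => (1 : ℝ)) (θ₀ := fun _ => (1 : ℝ)) (u₀ := fun _ => (0 : V3))
      continuous_const continuous_const continuous_const (fun _ => one_pos) (fun _ => one_pos) hσ2 N (Φ N)
  -- the fixed-`N` weighted assembly
  refine lintegral_weightedSplit_le (localGibbsLaw σ a₀ u₀ θ₀ N (Φ N)) (eqLaw σ N (Φ N)) τ hh0 hh1 hδ'0.le hA hL0 hT.le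
    hKL (fun z k q hq => ?_) (fun z k q hq => ?_) (fun z k q hq => ?_) (fun z k q hq => ?_)
    (fun k q z => weighted_nonneg (ownedCount_nonneg hc0.le hσ (Φ N) k q z) hT.le)
    (fun k q z => weighted_le_T _ hT.le)
    (fun k q z => clmIndicatorW_le hh0.le ϑs ϑ ϑh φs b m₀ _ q (ownedCount_nonneg hc0.le hσ (Φ N) k q z) hT.le)
    (fun k q => ((measurableSet_pop_nonempty c σ q).preimage ((Φ N).measurable_flow _)).inter
      ((measurableSet_dense φs c σ q).preimage ((Φ N).measurable_flow _)))
    (fun k q => cesaroW_measurableSet_irregularB (Φ N) ϑs ϑh b c _ m₀ q) (hNM N hNM') (hNU N hNU') (hNI N hNI') ?_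
  · -- the weighted non-Maxwellian family is box-supported (empty population off the box)
    simp [pop_eq_empty_of_not_mem hh0 _ hq]
  · -- the weighted regular family is box-supported (no owned collision off the box)
    rw [ownedCount_eq_zero_of_not_mem hh0 (Φ N) k hq z, min_eq_left hT.le, mul_zero]
  · -- the packed family is box-supported
    simp [pop_eq_empty_of_not_mem hh0 _ hq]
  · -- the irregularity family is box-supported (actual cells lie in the box)
    rw [if_neg]
    rintro ⟨⟨x, hx⟩, -⟩
    exact hq (hx ▸ cellOf_mem_cellBox hh0 x)
  · -- tolerances add up
    rw [hLval, ← ENNReal.ofReal_mul hT.le, hTval, ← ENNReal.ofReal_add (by positivity) (by positivity),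
      ← ENNReal.ofReal_add (by positivity) (by positivity)]
    refine ENNReal.ofReal_le_ofReal (le_of_eq ?_)
    rw [hδ']
    ring

end Summit.AtomisticToContinuum.HydrodynamicLimit.Theorems.EquilibriumForecastLine

end
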